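import Summits.HubbardSuperconductivity.HubbardSuperconductivity.Theorems.SoloBlindPlaquetteDefs
import HarnessLib

/-!
# Plaquette Mott floor — black plaquettes of the even torus (Theorem 42, part 3/5)

Solo-blind programme `HubbardSuperconductivity`, generation 55 — the *plaquette Mott floor*
(Theorem 42, `SoloBlindPlaquetteMottFloor.plaquette_mott_floor`): for `U ≥ 16`, `L` even and every
`N`-particle `ψ`, `re ⟨ψ, H_U ψ⟩ ≥ -(4 N_h - (2 - √2)·max(0, 4 N_h - L²) + 64 L²/U) ‖ψ‖²`,
`N_h = L² - N`, sharpening the Mott floor `-(4 N_h + 64 L²/U)` of `SoloBlindMottFloor` by letting the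
AM–GM weight of a (sign-free) hole hop depend on the hole pattern of the black plaquette containing
the bond.

This file: on `(ℤ/L)²` with `L` even, stepping along a bond flips blackness (`parity_add_one`,
`isBlack_add_e1`, …); every nearest-neighbour bond is one of the eight local ordered bonds
`(k + off (src i), k + off (dst i))` of a black plaquette `k` (`exists_black`); every site is a corner
of exactly two black plaquettes (`sum_black_corner`: `Σ_{k black} Σ_c f (k + off c) = 2 Σ_z f z`);
and `#black = L²/2` (`card_blackSet`).

[this work; folklore]
-/

noncomputable section

namespace Summit.HubbardSuperconductivity.HubbardSuperconductivity.Theorems.PlaquetteMottFloor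

open Matrix Finset Literature.Probability.LatticeModels Literature.MathematicalPhysics.QuantumLattice
  Literature.MathematicalPhysics.QuantumLattice.EigenvalueContinuation
  Summit.HubbardSuperconductivity.HubbardSuperconductivity.Theorems.MottFloor
open scoped ComplexOrder ComplexConjugate

variable {L : ℕ} [NeZero L]

/-- A positive even side is at least `2`. [folklore] -/
private theorem two_le_of_even' (hL : Even L) : 2 ≤ L := by
  have h0 : L ≠ 0 := NeZero.ne L
  obtain ⟨r, hr⟩ := hL
  omega

/-- **Parity flips under `+1` on `ℤ/L`, `L` even** (with or without wrap-around). [folklore] -/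
theorem parity_add_one (hL : Even L) (z : ZMod L) : ((z + 1).val + z.val) % 2 = 1 := by
  haveI : Fact (1 < L) := ⟨lt_of_lt_of_le one_lt_two (two_le_of_even' hL)⟩
  have hlt := ZMod.val_lt z
  obtain ⟨r, hr⟩ := hL
  rw [ZMod.val_add, ZMod.val_one]
  rcases Nat.lt_or_ge (z.val + 1) L with h | h
  · rw [Nat.mod_eq_of_lt h]; omega
  · have hE : z.val + 1 = L := by omega
    rw [hE, Nat.mod_self]; omega

omit [NeZero L] in
/-- Coordinates of `k + e₁`. [folklore] -/
private theorem add_e1_apply (k : TorusSite 2 L) :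
    (k + (Pi.single 0 1 : TorusSite 2 L)) 0 = k 0 + 1 ∧ (k + (Pi.single 0 1 : TorusSite 2 L)) 1 = k 1 := by
  constructor <;> simp

omit [NeZero L] in
/-- Coordinates of `k + e₂`. [folklore] -/
private theorem add_e2_apply (k : TorusSite 2 L) :
    (k + (Pi.single 1 1 : TorusSite 2 L)) 0 = k 0 ∧ (k + (Pi.single 1 1 : TorusSite 2 L)) 1 = k 1 + 1 := by
  constructor <;> simp

/-- `k + e₁` is black iff `k` is not. [folklore] -/
theorem isBlack_add_e1 (hL : Even L) (k : TorusSite 2 L) :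
    IsBlack (k + Pi.single 0 1) ↔ ¬ IsBlack k := by
  have hp := parity_add_one hL (k 0)
  simp only [IsBlack, (add_e1_apply k).1, (add_e1_apply k).2]
  omega

/-- `k + e₂` is black iff `k` is not. [folklore] -/
theorem isBlack_add_e2 (hL : Even L) (k : TorusSite 2 L) :
    IsBlack (k + Pi.single 1 1) ↔ ¬ IsBlack k := by
  have hp := parity_add_one hL (k 1)
  simp only [IsBlack, (add_e2_apply k).1, (add_e2_apply k).2]
  omega

/-- `k - e₁` is black iff `k` is not. [folklore] -/
theorem isBlack_sub_e1 (hL : Even L) (k : TorusSite 2 L) :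
    IsBlack (k - Pi.single 0 1) ↔ ¬ IsBlack k := by
  have h := isBlack_add_e1 hL (k - Pi.single 0 1)
  rw [sub_add_cancel] at h
  tauto

/-- `k - e₂` is black iff `k` is not. [folklore] -/
theorem isBlack_sub_e2 (hL : Even L) (k : TorusSite 2 L) :
    IsBlack (k - Pi.single 1 1) ↔ ¬ IsBlack k := by
  have h := isBlack_add_e2 hL (k - Pi.single 1 1)
  rw [sub_add_cancel] at h
  tauto

/-- `k - (e₁ + e₂)` is black iff `k` is. [folklore] -/
theorem isBlack_sub_e12 (hL : Even L) (k : TorusSite 2 L) :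
    IsBlack (k - (Pi.single 0 1 + Pi.single 1 1)) ↔ IsBlack k := by
  have h1 := isBlack_sub_e1 hL (k - Pi.single 1 1)
  have h2 := isBlack_sub_e2 hL k
  rw [show k - (Pi.single 0 1 + Pi.single 1 1) = k - Pi.single 1 1 - Pi.single 0 1 by abel]
  tauto

omit [NeZero L] in
/-- The four corner offsets are distinct (`L > 1`). [folklore] -/
theorem off_injective (hL : 1 < L) : Function.Injective (off (L := L)) := by
  haveI : Fact (1 < L) := ⟨hL⟩
  intro c c' h
  have e0 : off (L := L) c 0 = off (L := L) c' 0 := by rw [h]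
  have e1 : off (L := L) c 1 = off (L := L) c' 1 := by rw [h]
  fin_cases c <;> fin_cases c' <;>
    first
    | rfl
    | (exfalso
       simp [off_zero, off_one, off_two, off_three] at e0 e1)

/-- **Every bond lies in a black plaquette**: if `x ∼ y` on the even torus then `(x, y)` is a local
ordered bond `(k + off (src i), k + off (dst i))` of some black plaquette `k`. [this work] -/
theorem exists_black (hL : Even L) {x y : TorusSite 2 L} (h : (torusGraph 2 L).Adj x y) :
    ∃ q : TorusSite 2 L × (Fin 4 × Bool),
      IsBlack q.1 ∧ q.1 + off (src q.2) = x ∧ q.1 + off (dst q.2) = y := by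
  have a01 : ((0 : Fin 4) + 1) = 1 := rfl
  have a12 : ((1 : Fin 4) + 1) = 2 := rfl
  have a23 : ((2 : Fin 4) + 1) = 3 := rfl
  have a30 : ((3 : Fin 4) + 1) = 0 := rfl
  rcases (torusGraph_adj_iff x y).1 h with ⟨-, ⟨j, hj⟩ | ⟨j, hj⟩⟩
  · -- `y = x + e_j`
    fin_cases j
    · by_cases hx : IsBlack x
      · refine ⟨(x, ((0 : Fin 4), true)), hx, ?_, ?_⟩
        · show x + off (src (0, true)) = x
          rw [src_true, off_zero, add_zero]
        · show x + off (dst (0, true)) = y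
          rw [dst_true, a01, off_one, hj]; rfl
      · refine ⟨(x - Pi.single 1 1, ((2 : Fin 4), false)), (isBlack_sub_e2 hL x).2 hx, ?_, ?_⟩
        · show x - Pi.single 1 1 + off (src (2, false)) = x
          rw [src_false, a23, off_three, sub_add_cancel]
        · show x - Pi.single 1 1 + off (dst (2, false)) = y
          rw [dst_false, off_two, hj]
          simp only [Fin.isValue]
          abel
    · by_cases hx : IsBlack x
      · refine ⟨(x, ((3 : Fin 4), false)), hx, ?_, ?_⟩
        · show x + off (src (3, false)) = x
          rw [src_false, a30, off_zero, add_zero]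
        · show x + off (dst (3, false)) = y
          rw [dst_false, off_three, hj]; rfl
      · refine ⟨(x - Pi.single 0 1, ((1 : Fin 4), true)), (isBlack_sub_e1 hL x).2 hx, ?_, ?_⟩
        · show x - Pi.single 0 1 + off (src (1, true)) = x
          rw [src_true, off_one, sub_add_cancel]
        · show x - Pi.single 0 1 + off (dst (1, true)) = y
          rw [dst_true, a12, off_two, hj]
          simp only [Fin.isValue]
          abel
  · -- `x = y + e_j`
    fin_cases j
    · by_cases hy : IsBlack y
      · refine ⟨(y, ((0 : Fin 4), false)), hy, ?_, ?_⟩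
        · show y + off (src (0, false)) = x
          rw [src_false, a01, off_one, hj]; rfl
        · show y + off (dst (0, false)) = y
          rw [dst_false, off_zero, add_zero]
      · refine ⟨(y - Pi.single 1 1, ((2 : Fin 4), true)), (isBlack_sub_e2 hL y).2 hy, ?_, ?_⟩
        · show y - Pi.single 1 1 + off (src (2, true)) = x
          rw [src_true, off_two, hj]
          simp only [Fin.isValue]
          abel
        · show y - Pi.single 1 1 + off (dst (2, true)) = y
          rw [dst_true, a23, off_three, sub_add_cancel]
    · by_cases hy : IsBlack y
      · refine ⟨(y, ((3 : Fin 4), true)), hy, ?_, ?_⟩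
        · show y + off (src (3, true)) = x
          rw [src_true, off_three, hj]; rfl
        · show y + off (dst (3, true)) = y
          rw [dst_true, a30, off_zero, add_zero]
      · refine ⟨(y - Pi.single 0 1, ((1 : Fin 4), false)), (isBlack_sub_e1 hL y).2 hy, ?_, ?_⟩
        · show y - Pi.single 0 1 + off (src (1, false)) = x
          rw [src_false, a12, off_two, hj]
          simp only [Fin.isValue]
          abel
        · show y - Pi.single 0 1 + off (dst (1, false)) = y
          rw [dst_false, off_one, sub_add_cancel]

/-- **Every site is a corner of exactly two black plaquettes**:
`Σ_{k black} Σ_c f (k + off c) = 2 Σ_z f z`. [this work] -/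
theorem sum_black_corner (hL : Even L) (f : TorusSite 2 L → ℝ) :
    ∑ k ∈ blackSet L, ∑ c, f (k + off c) = 2 * ∑ z, f z := by
  rw [Finset.sum_comm]
  have hre : ∀ c : Fin 4, ∑ k ∈ blackSet L, f (k + off c) =
      ∑ z, (if IsBlack (z - off c) then f z else 0) := by
    intro c
    rw [blackSet, Finset.sum_filter]
    rw [← Equiv.sum_comp (Equiv.addRight (off (L := L) c)) (fun z => if IsBlack (z - off c) then f z else 0)]
    refine Finset.sum_congr rfl fun k _ => ?_
    simp only [Equiv.coe_addRight, add_sub_cancel_right]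
  simp_rw [hre]
  rw [Fin.sum_univ_four, ← Finset.sum_add_distrib, ← Finset.sum_add_distrib, ← Finset.sum_add_distrib,
    Finset.mul_sum]
  refine Finset.sum_congr rfl fun z _ => ?_
  have h0 : IsBlack (z - off 0) ↔ IsBlack z := by rw [off_zero, sub_zero]
  have h1 : IsBlack (z - off 1) ↔ ¬ IsBlack z := by rw [off_one]; exact isBlack_sub_e1 hL z
  have h2 : IsBlack (z - off 2) ↔ IsBlack z := by rw [off_two]; exact isBlack_sub_e12 hL z
  have h3 : IsBlack (z - off 3) ↔ ¬ IsBlack z := by rw [off_three]; exact isBlack_sub_e2 hL z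
  by_cases hz : IsBlack z
  · rw [if_pos (h0.2 hz), if_neg (fun h => h1.1 h hz), if_pos (h2.2 hz), if_neg (fun h => h3.1 h hz)]
    ring
  · rw [if_neg (fun h => hz (h0.1 h)), if_pos (h1.2 hz), if_neg (fun h => hz (h2.1 h)), if_pos (h3.2 hz)]
    ring

/-- The torus has `L²` sites (file-local copy of a folklore fact). -/
private theorem card_torusSite' : Fintype.card (TorusSite 2 L) = L ^ 2 := by
  simp [Fintype.card_pi, ZMod.card]

/-- **Half of the plaquettes are black**: `#black = L²/2` on an even torus. [folklore] -/
theorem card_blackSet (hL : Even L) : ((blackSet L).card : ℝ) = (L : ℝ) ^ 2 / 2 := by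
  have h := sum_black_corner hL (fun _ => (1 : ℝ))
  simp only [Finset.sum_const, Finset.card_univ, Fintype.card_fin, nsmul_eq_mul, mul_one,
    card_torusSite'] at h
  push_cast at h
  linarith

end Summit.HubbardSuperconductivity.HubbardSuperconductivity.Theorems.PlaquetteMottFloor
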